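import Mathlib.Analysis.SpecialFunctions.Pow.Real
import Mathlib.Algebra.BigOperators.Intervals
import Mathlib.Tactic
import Summits.CriticalPhenomena.PercolationContinuityZ3.Theorems.PercNearOneGluingNoHeavyLowerTailLogConcaveCycles
import Summits.CriticalPhenomena.PercolationContinuityZ3.Theorems.PercNearOneGluingNoHeavyLowerTailSpecialPointGrid
import HarnessLib

/-!
# The peeling lemma: mixed log-supermodularity from a TP₂ kernel pair and a Bender–Canfield bulk

Support file for the Sahi / Conjecture-P programme of route `PercNearOneGluingNoHeavy`
(`--supports stmt-CriticalPhenomena-4575`, prover prim-l12-p5 gen 24; proof note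
`prim-l12-p5/FRESH-CYCLE-g24.md` §5, Theorem 5.2(a) — the analytic core of the DOUBLE PEELING).
Companions: `…LowerTailSpecialPointGrid` (`gt_mono`), `…LowerTailLogConcaveCycles` (`abel_nonneg`),
`…LowerTailTwoBlockSquare`.  No definitions, no named facts, no sorries.

Setting (note §5): `u` is the normalised partition function of an exchangeable bulk and `U` its partial
sums (`U` log-concave by Bender–Canfield, whence `gt_mono`: `u_{a+1} U_k ≤ u_a U_{k+1}`, `k ≤ a`);
`K, L ≥ 0` are two consecutive kernels (`K = W(·,c)/·!`, `L = W(·,c+1)/·!`) with the TP₂ comparison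
`L b K b' ≤ K b L b'` (`b < b'`) whose differences `ΔK(b,b') = K b L b' − L b K b'` are nondecreasing
in `b'`.  With `V a = ∑_{b ≤ a} K b u_{a−b}` and `W a = ∑_{b ≤ a} L b u_{a−b}` (the two levels of the
two-block partition function) the conclusion `peel` is `V (a+1) W a ≤ W (a+1) V a`, i.e. the mixed
log-supermodularity `Zc(a+1,c+1) Zc(a,c) ≥ Zc(a+1,c) Zc(a,c+1)` of Theorem 5.2(a).
Proof: the difference is `∑_{b'<b} ΔK(b',b) E(b',b)` (antisymmetrisation of the double sum,
`sum_square_split`), and for fixed `b'` the inner sum is nonnegative by Abel summation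
(`abel_nonneg`) because its reflected partial sums are `u_j U_K − u_{j+1} U_{K−1} ≥ 0` (`gt_mono`).
-/

namespace Summit.CriticalPhenomena.PercolationContinuityZ3.Theorems

namespace TwoBlockPeel

open Finset

/-- Splitting a sum over a square into the diagonal and the symmetrised strictly-lower part. -/
theorem sum_square_split (f : ℕ → ℕ → ℝ) (n : ℕ) :
    ∑ b ∈ range n, ∑ b' ∈ range n, f b b' =
      ∑ b ∈ range n, f b b + ∑ b' ∈ range n, ∑ b ∈ Ico (b' + 1) n, (f b b' + f b' b) := by
  induction n with
  | zero => simp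
  | succ n ih =>
    -- peel the last row and the last column
    rw [Finset.sum_range_succ (fun b => ∑ b' ∈ range (n + 1), f b b')]
    have hrows : ∑ b ∈ range n, ∑ b' ∈ range (n + 1), f b b' =
        ∑ b ∈ range n, ∑ b' ∈ range n, f b b' + ∑ b ∈ range n, f b n := by
      rw [← Finset.sum_add_distrib]
      exact Finset.sum_congr rfl fun b _ => Finset.sum_range_succ _ _
    rw [hrows, ih, Finset.sum_range_succ (fun b' => f b' b'), Finset.sum_range_succ (f n)]
    rw [Finset.sum_range_succ (fun b' => ∑ b ∈ Ico (b' + 1) (n + 1), (f b b' + f b' b))]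
    have hIco : ∀ b' ∈ range n, ∑ b ∈ Ico (b' + 1) (n + 1), (f b b' + f b' b) =
        ∑ b ∈ Ico (b' + 1) n, (f b b' + f b' b) + (f n b' + f b' n) := by
      intro b' hb'
      rw [Finset.mem_range] at hb'
      rw [Finset.sum_Ico_succ_top (by omega)]
    rw [Finset.sum_congr rfl hIco, Finset.sum_add_distrib, Finset.Ico_self, Finset.sum_empty]
    have e2 : ∑ b' ∈ range n, (f n b' + f b' n) = ∑ b' ∈ range n, f n b' + ∑ b' ∈ range n, f b' n :=
      Finset.sum_add_distrib
    rw [e2]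
    ring

variable {u U : ℕ → ℝ}

/-- Reflected partial sums of `D_j(i) := u_j u_i − [i ≥ 1] u_{j+1} u_{i−1}`:
`∑_{i<K} D_j(i) = u_j U_{K−1} − u_{j+1} U_{K−2}` (with `U_{−1} = U_{−2} = 0`). -/
theorem partial_D (hU0 : U 0 = u 0) (hUs : ∀ k, U (k + 1) = U k + u (k + 1)) (j : ℕ) :
    ∀ K, ∑ i ∈ range K, (u j * u i - (if i = 0 then 0 else u (j + 1) * u (i - 1))) =
      u j * (if K = 0 then 0 else U (K - 1)) - u (j + 1) * (if K ≤ 1 then 0 else U (K - 2)) := by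
  intro K
  induction K with
  | zero => simp
  | succ K ih =>
    rw [Finset.sum_range_succ, ih]
    rcases K with _ | K
    · simp [hU0]
    · rcases K with _ | K
      · simp [hU0, hUs 0]; ring
      · simp only [Nat.succ_ne_zero, if_false, Nat.add_sub_cancel, show ¬ (K + 1 + 1 ≤ 1) by omega,
          show ¬ (K + 1 + 1 + 1 ≤ 1) by omega, show K + 1 + 1 - 2 = K by omega,
          show K + 1 + 1 + 1 - 2 = K + 1 by omega, show K + 1 + 1 - 1 = K + 1 by omega]
        rw [hUs (K + 1), hUs K]
        ring

/-- The inner Abel sum: for `j` fixed and nonincreasing nonnegative multipliers `lam`,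
`∑_{i ≤ j} lam_i D_j(i) ≥ 0`. -/
theorem inner_nonneg (hU0 : U 0 = u 0) (hUs : ∀ k, U (k + 1) = U k + u (k + 1)) (hUpos : ∀ k, 0 < U k)
    (hupos : ∀ k, 0 < u k) (hlc : ∀ k, U k * U (k + 2) ≤ U (k + 1) * U (k + 1))
    (j : ℕ) (lam : ℕ → ℝ) (hlam : ∀ i, i < j → lam (i + 1) ≤ lam i) (hlam0 : ∀ i, 0 ≤ lam i) :
    0 ≤ ∑ i ∈ range (j + 1), lam i * (u j * u i - (if i = 0 then 0 else u (j + 1) * u (i - 1))) := by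
  apply LogConcaveCycles.abel_nonneg lam _ j hlam hlam0
  intro K hK
  rw [partial_D hU0 hUs j K]
  rcases K with _ | K
  · simp
  · rcases K with _ | K
    · simp
      exact mul_nonneg (hupos j).le (by rw [hU0]; exact (hupos 0).le)
    · simp only [Nat.succ_ne_zero, if_false, show ¬ (K + 1 + 1 ≤ 1) by omega,
        show K + 1 + 1 - 1 = K + 1 by omega, show K + 1 + 1 - 2 = K by omega]
      have := SpecialPointGrid.gt_mono hU0 hUs hUpos hupos hlc K j (by omega)
      linarith

/-- **The peeling lemma (Theorem 5.2(a) of the note).**  `V (a+1) · W a ≤ W (a+1) · V a` for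
`V a = ∑_{b ≤ a} K b u_{a-b}`, `W a = ∑_{b ≤ a} L b u_{a-b}`, whenever `U` (partial sums of `u > 0`) is
log-concave, `K, L ≥ 0`, `L b K b' ≤ K b L b'` for `b < b'` (TP₂) and `b' ↦ K b L b' − L b K b'` is
nondecreasing on `b' > b`. -/
theorem peel (hU0 : U 0 = u 0) (hUs : ∀ k, U (k + 1) = U k + u (k + 1)) (hUpos : ∀ k, 0 < U k)
    (hupos : ∀ k, 0 < u k) (hlc : ∀ k, U k * U (k + 2) ≤ U (k + 1) * U (k + 1))
    (K L : ℕ → ℝ) (hTP : ∀ b b', b < b' → L b * K b' ≤ K b * L b')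
    (hmono : ∀ b b', b < b' → K b * L b' - L b * K b' ≤ K b * L (b' + 1) - L b * K (b' + 1)) (a : ℕ) :
    (∑ b ∈ range (a + 2), K b * u (a + 1 - b)) * (∑ b ∈ range (a + 1), L b * u (a - b)) ≤
      (∑ b ∈ range (a + 2), L b * u (a + 1 - b)) * (∑ b ∈ range (a + 1), K b * u (a - b)) := by
  -- zero-extended second factor: h b' := u (a - b') for b' ≤ a, 0 for b' = a+1
  set h : ℕ → ℝ := fun b' => if b' ≤ a then u (a - b') else 0 with hh
  have hV : ∀ (M : ℕ → ℝ), ∑ b ∈ range (a + 1), M b * u (a - b) = ∑ b ∈ range (a + 2), M b * h b := by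
    intro M
    rw [Finset.sum_range_succ (fun b => M b * h b) (a + 1)]
    have hz : h (a + 1) = 0 := by simp [hh]
    rw [hz, mul_zero, add_zero]
    refine Finset.sum_congr rfl fun b hb => ?_
    rw [Finset.mem_range] at hb
    simp [hh, show b ≤ a by omega]
  rw [hV L, hV K]
  -- the difference as a double sum of f b b' := (L b K b' − K b L b') u(a+1−b) h(b')
  set f : ℕ → ℕ → ℝ := fun b b' => (L b * K b' - K b * L b') * u (a + 1 - b) * h b' with hf
  have hdiff : (∑ b ∈ range (a + 2), L b * u (a + 1 - b)) * (∑ b ∈ range (a + 2), K b * h b) -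
      (∑ b ∈ range (a + 2), K b * u (a + 1 - b)) * (∑ b ∈ range (a + 2), L b * h b) =
      ∑ b ∈ range (a + 2), ∑ b' ∈ range (a + 2), f b b' := by
    rw [Finset.sum_mul_sum, Finset.sum_mul_sum, ← Finset.sum_sub_distrib]
    refine Finset.sum_congr rfl fun b _ => ?_
    rw [← Finset.sum_sub_distrib]
    refine Finset.sum_congr rfl fun b' _ => ?_
    simp only [hf]; ring
  have hsq := sum_square_split f (a + 2)
  have hdiag : ∑ b ∈ range (a + 2), f b b = 0 := Finset.sum_eq_zero fun b _ => by simp only [hf]; ring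
  -- each symmetrised inner sum is an Abel sum ≥ 0
  have hinner : ∀ b' ∈ range (a + 2), 0 ≤ ∑ b ∈ Ico (b' + 1) (a + 2), (f b b' + f b' b) := by
    intro b' hb'
    rw [Finset.mem_range] at hb'
    rcases Nat.lt_or_ge a b' with hgt | hle
    · -- b' = a + 1: empty range
      rw [show b' = a + 1 by omega, Finset.Ico_self, Finset.sum_empty]
    · -- reflect: b = a + 1 - i, i ∈ [0, a - b']
      set j := a - b' with hj
      have hpair : ∀ b ∈ Ico (b' + 1) (a + 2), f b b' + f b' b =
          (K b' * L b - L b' * K b) * (u (a + 1 - b) * u (a - b') - u (a + 1 - b') * h b) := by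
        intro b hb
        rw [Finset.mem_Ico] at hb
        have : h b' = u (a - b') := by simp [hh, hle]
        simp only [hf, this]; ring
      rw [Finset.sum_congr rfl hpair]
      -- rewrite as a sum over i ∈ range (j+1) of lam i * D j i
      have hrefl : ∑ b ∈ Ico (b' + 1) (a + 2),
          (K b' * L b - L b' * K b) * (u (a + 1 - b) * u (a - b') - u (a + 1 - b') * h b) =
          ∑ i ∈ range (j + 1), (K b' * L (a + 1 - i) - L b' * K (a + 1 - i)) *
            (u j * u i - (if i = 0 then 0 else u (j + 1) * u (i - 1))) := by
        rw [Finset.sum_Ico_eq_sum_range, show a + 2 - (b' + 1) = j + 1 by omega]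
        rw [← Finset.sum_range_reflect _ (j + 1)]
        refine Finset.sum_congr rfl fun i hi => ?_
        rw [Finset.mem_range] at hi
        have e1 : b' + 1 + (j + 1 - 1 - i) = a + 1 - i := by omega
        rw [e1]
        have e2 : a + 1 - (a + 1 - i) = i := by omega
        have e3 : a - b' = j := hj.symm
        have e4 : a + 1 - b' = j + 1 := by omega
        rw [e2, e3, e4]
        rcases Nat.eq_zero_or_pos i with hi0 | hipos
        · subst hi0
          have : h (a + 1 - 0) = 0 := by simp [hh]
          rw [this, if_pos rfl]; ring
        · have : h (a + 1 - i) = u (i - 1) := by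
            simp only [hh, show a + 1 - i ≤ a by omega, if_true]
            congr 1; omega
          rw [this, if_neg (by omega)]
          ring
      rw [hrefl]
      -- multipliers lam i := ΔK(b', a+1-i) for i ≤ j, else 0
      have key := inner_nonneg hU0 hUs hUpos hupos hlc j
        (fun i => if i ≤ j then K b' * L (a + 1 - i) - L b' * K (a + 1 - i) else 0)
        (by
          intro i hi
          simp only [show i + 1 ≤ j by omega, show i ≤ j by omega, if_true]
          have := hmono b' (a + 1 - (i + 1)) (by omega)
          rw [show a + 1 - (i + 1) + 1 = a + 1 - i by omega] at this
          linarith)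
        (by
          intro i
          by_cases hi : i ≤ j
          · simp only [hi, if_true]
            have := hTP b' (a + 1 - i) (by omega)
            linarith
          · simp [hi])
      refine le_trans key (le_of_eq ?_)
      refine Finset.sum_congr rfl fun i hi => ?_
      rw [Finset.mem_range] at hi
      simp [show i ≤ j by omega]
  have htot : 0 ≤ ∑ b ∈ range (a + 2), ∑ b' ∈ range (a + 2), f b b' := by
    rw [hsq, hdiag, zero_add]
    exact Finset.sum_nonneg hinner
  linarith [hdiff, htot]

end TwoBlockPeel

end Summit.CriticalPhenomena.PercolationContinuityZ3.Theorems
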